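import Summits.QuantumFields.YangMills.Theorems.BalabanUVNodesN19SingleModeMomentLogFree
import Summits.QuantumFields.YangMills.Theorems.BalabanUVNodesN19JointLawClosedFormAtScheme

/-!
# YM-DAG node N19 (= NE7 proper) — THE LOG-FREE SINGLE MODE OF `d` STRINGS AT THE SCHEME (module 67's push-forward BY NAME):
# `|∫cos(ωΣ_i|∏os_i|)dgibbs_K − ∫cos(ωΣ_i|x_i|)dν| ≤ 340·ωd∕L + e^{−L∕2}` whenever `R_K ≤ e^{−L}`, under the uniform `Target`

Cell `pub-ymgap`, HUMAN RULING D-0062 (Track A) ∕ D-0149 (work-bound push), R141 (C) wider-strategy seat `pub-ymgap-dag-n19-e` (strategy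
s3 = ALTERNATIVE CURRENCY), generation g32, module 10 (lineage module 148).  Route `Summits/QuantumFields/YangMills/Theses/BalabanUVNodes.lean`,
cluster item K3⁸ «SpineGivenEndpointR13SepCoPHV» (stmt-QuantumFields-27366); filed `--supports` that item `--as helper` (it proves no registered
stub).  COUNT-NEUTRAL: [bookkeeping] over the lineage BY NAME — module 67 `…N19JointLawClosedFormAtScheme` (`jointLaw_pushforward`: the step-`K`
joint law of a finite family of strings is a law on `[−1,1]^ι` whose mixed moments are `R_K`-close to the continuum joint law's, CONDITIONAL on the
uniform `Spine.NE7.Target`) and module 146 `…N19SingleModeMomentLogFree` (`abs_integral_{cos,sin}_l1Norm_sub_le_logFree`); the scheme object appears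
only through module 67; nothing of Bałaban's instantiated; NOT a discharge claim.

CONTENT.  ★ `abs_integral_cos_l1Norm_sub_jointLaw_le_logFree` ∕ `…sin…`: under `Spine.NE7.Target vol l₀ δ (schemeZ S os)` for EVERY string (`0 < l₀`),
for a finite family `os : ι → List O` with a continuum joint law `ν` on `[−1,1]^ι` receiving all continuous functionals, a frequency `ω ≥ 0`, every step
`K` and every budget `L ≥ 1024` with `ωd·(log₂L)² ≤ L∕16384` and `R_K ≤ e^{−L}`
(`R_K = (4e^{1+l₀}∕l₀)·τ_K·(1 + log⁺τ_K⁻¹)`, `τ_K = Σ_j 2vol·δ_{K+j}`):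
`|∫cos(ω·Σ_i|∏os_i|)dgibbs_K − ∫cos(ω·Σ_i|x_i|)dν| ≤ 340·ωd∕L + e^{−L∕2}` — module 130's row (`248(J+1)ωd∕2^J + 9^{6(J+1)2^J}R_K`, reading
`≲ ωd·log²L_K∕L_K`) WITHOUT the logarithms: at `L = L_K := log R_K⁻¹` the single mode of `d` strings along the tower costs `340·ωd∕L_K + √R_K`.

HONEST FRAMING (binding).  [bookkeeping]; CONDITIONAL on the uniform `Target` (a hypothesis, NOT proved); TOY continuum law `ν` under hypotheses; NO
consumer in the DAG today; nothing of Bałaban's instantiated; NE7 NOT PRINTED, NOT proved; N19 NOT discharged; count-neutral.  One finite `T⁴`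
programme at fixed `ε`; nothing continuum ∕ `ℝ⁴` ∕ OS ∕ mass-gap ∕ Clay.  0 `def` ∕ 0 `sorry`.
-/

noncomputable section

open Real Finset MeasureTheory Filter Topology

namespace Summit.QuantumFields.YangMills.Theorems.BalabanUVNodesN19SingleModeMomentLogFreeAtScheme

open Literature.MathematicalPhysics.QuantumFieldTheory.Balaban1983to89
open T4GenFunBounds (prodObs gibbsMeasure schemeZ)
open Missing (TorusScheme)
open Summit.QuantumFields.BalabanUV.T4Continuum.Spine
open Summit.QuantumFields.YangMills.Theorems.BalabanUVNodesN19JointLawClosedFormAtScheme (jointLaw_pushforward)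
open Summit.QuantumFields.YangMills.Theorems.BalabanUVNodesN19SingleModeMomentLogFree
  (abs_integral_cos_l1Norm_sub_le_logFree abs_integral_sin_l1Norm_sub_le_logFree)

variable {ι : Type*} [Fintype ι]
variable {G : Type*} [GaugeGroup G] [MeasurableSpace G] [RegularGaugeGroup G] [HaarData G] {O : Type*}
  (S : TorusScheme G O) (hβ : ∀ K, 0 ≤ S.β K) (hm : ∀ K o, Measurable (S.obs K o)) (h1 : ∀ K o U, |S.obs K o U| ≤ 1)
include hβ hm h1

/-- ★ **THE SINGLE MODE `cos` OF `d` STRINGS AT THE SCHEME, LOG-FREE.**  Under `Spine.NE7.Target vol l₀ δ (schemeZ S os)` for EVERY string (`0 < l₀`),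
for a finite family `os : ι → List O` with a continuum joint law `ν` on `[−1,1]^ι` receiving all continuous functionals, `ω ≥ 0`, every step `K` and every
`L ≥ 1024` with `ωd·(log₂L)² ≤ L∕16384` (`d = |ι|`) and `R_K ≤ e^{−L}`:
`|∫ cos(ω·Σ_i|∏os_i|) dgibbs_K − ∫ cos(ω·Σ_i|x_i|) dν| ≤ 340·ωd∕L + e^{−L∕2}` (module 146 at `r = e^{−L}` on module 67's push-forward).
CONDITIONAL on the uniform `Target`; nothing of Bałaban's instantiated. [bookkeeping] -/
theorem abs_integral_cos_l1Norm_sub_jointLaw_le_logFree {vol l₀ : ℝ} {δ : ℕ → ℝ}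
    (hl₀ : 0 < l₀) (hT : ∀ os : List O, NE7.Target vol l₀ δ (schemeZ S os)) (os : ι → List O) (ν : Measure (ι → ℝ)) [IsProbabilityMeasure ν]
    (hν1 : ν (Set.pi Set.univ (fun _ : ι => Set.Icc (-1 : ℝ) 1))ᶜ = 0)
    (hν : ∀ f : (ι → ℝ) → ℝ, Continuous f →
      Tendsto (fun K => ∫ U, f (fun i => prodObs S K (os i) U) ∂gibbsMeasure (S.P K) (S.β K)) atTop (𝓝 (∫ x, f x ∂ν)))
    {ω : ℝ} (hω : 0 ≤ ω) (K : ℕ) {L : ℝ} (hL : 1024 ≤ L) (hreg : ω * Fintype.card ι * Real.logb 2 L ^ 2 ≤ L / 16384)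
    (hRL : 4 * Real.exp (1 + l₀) / l₀ * (∑' j, 2 * (vol * δ (K + j))) * (1 + Real.posLog (∑' j, 2 * (vol * δ (K + j)))⁻¹) ≤ Real.exp (-L)) :
    |∫ U, Real.cos (ω * ∑ i, |prodObs S K (os i) U|) ∂gibbsMeasure (S.P K) (S.β K) - ∫ x, Real.cos (ω * ∑ i, |x i|) ∂ν| ≤
      340 * (ω * Fintype.card ι) / L + Real.exp (-L / 2) := by
  obtain ⟨P, iP, hPc, hint, -, hmom⟩ := jointLaw_pushforward S hβ hm h1 hl₀ hT os ν hν K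
  have hc : Continuous fun x : ι → ℝ => Real.cos (ω * ∑ i, |x i|) :=
    Real.continuous_cos.comp (continuous_const.mul (continuous_finsetSum _ fun i _ => (continuous_apply i).abs))
  rw [← hint hc]
  exact abs_integral_cos_l1Norm_sub_le_logFree hPc hν1 hL (fun j => (hmom j).trans hRL) hω hreg

/-- ★ **THE SINGLE MODE `sin` OF `d` STRINGS AT THE SCHEME, LOG-FREE** (same hypotheses; the imaginary part). [bookkeeping] -/
theorem abs_integral_sin_l1Norm_sub_jointLaw_le_logFree {vol l₀ : ℝ} {δ : ℕ → ℝ}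
    (hl₀ : 0 < l₀) (hT : ∀ os : List O, NE7.Target vol l₀ δ (schemeZ S os)) (os : ι → List O) (ν : Measure (ι → ℝ)) [IsProbabilityMeasure ν]
    (hν1 : ν (Set.pi Set.univ (fun _ : ι => Set.Icc (-1 : ℝ) 1))ᶜ = 0)
    (hν : ∀ f : (ι → ℝ) → ℝ, Continuous f →
      Tendsto (fun K => ∫ U, f (fun i => prodObs S K (os i) U) ∂gibbsMeasure (S.P K) (S.β K)) atTop (𝓝 (∫ x, f x ∂ν)))
    {ω : ℝ} (hω : 0 ≤ ω) (K : ℕ) {L : ℝ} (hL : 1024 ≤ L) (hreg : ω * Fintype.card ι * Real.logb 2 L ^ 2 ≤ L / 16384)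
    (hRL : 4 * Real.exp (1 + l₀) / l₀ * (∑' j, 2 * (vol * δ (K + j))) * (1 + Real.posLog (∑' j, 2 * (vol * δ (K + j)))⁻¹) ≤ Real.exp (-L)) :
    |∫ U, Real.sin (ω * ∑ i, |prodObs S K (os i) U|) ∂gibbsMeasure (S.P K) (S.β K) - ∫ x, Real.sin (ω * ∑ i, |x i|) ∂ν| ≤
      340 * (ω * Fintype.card ι) / L + Real.exp (-L / 2) := by
  obtain ⟨P, iP, hPc, hint, -, hmom⟩ := jointLaw_pushforward S hβ hm h1 hl₀ hT os ν hν K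
  have hc : Continuous fun x : ι → ℝ => Real.sin (ω * ∑ i, |x i|) :=
    Real.continuous_sin.comp (continuous_const.mul (continuous_finsetSum _ fun i _ => (continuous_apply i).abs))
  rw [← hint hc]
  exact abs_integral_sin_l1Norm_sub_le_logFree hPc hν1 hL (fun j => (hmom j).trans hRL) hω hreg

end Summit.QuantumFields.YangMills.Theorems.BalabanUVNodesN19SingleModeMomentLogFreeAtScheme

end
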